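import Mathlib
import Literature.Geometry.Lorentzian.Basic

/-!
# Sketch — crux ideas of ideator 2 (round 1) on `stmt-FinalStateConjecture-17403` (`InertialRecession`, E′)

First lemmas of the two cards, over Mathlib + `Literature.Geometry.Lorentzian.Basic` (`E3`) only.

* Card A `coercivity-travels-by-analyticity`: `injective_family_iff_of_analytic` (PROVED here: the
  identity principle moves injectivity of a finite real-analytic family between any two nonempty open
  pieces of a preconnected domain) and the COER₁ shape `exists_finset_coercive` (statement; finite-
  dimensional linear algebra).
* Card B `two-monotonicities-bound-the-rebasings`: `slow_ratio_stays_below` (M1) and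
  `ballistic_passage_ordConnected` (M2), both PROVED.
-/

set_option linter.dupNamespace false

open scoped BigOperators Topology
open Filter Set Literature.Geometry.Lorentzian

namespace Summit.FinalStateConjecture.FinalStateConjecture.Cruxes.InertialRecession.SketchIdeator2R1

/-! ## Card A: coercivity travels by analyticity -/

/-- A vanishing combination on one nonempty open piece of a preconnected domain vanishes on the whole
domain (identity principle for finite sums of real-analytic functions). [folklore] -/
theorem combination_eqOn_zero_of_analytic {n : ℕ} {U W : Set E3} (f : Fin n → E3 → ℝ)
    (hU : IsPreconnected U) (hW : IsOpen W) (hWne : W.Nonempty) (hWU : W ⊆ U)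
    (hf : ∀ k, AnalyticOnNhd ℝ (f k) U) (c : Fin n → ℝ)
    (hc : ∀ x ∈ W, ∑ k, c k * f k x = 0) : ∀ x ∈ U, ∑ k, c k * f k x = 0 := by
  obtain ⟨z₀, hz₀⟩ := hWne
  have han : AnalyticOnNhd ℝ (fun x ↦ ∑ k, c k * f k x) U := by
    have h1 : AnalyticOnNhd ℝ (∑ k ∈ (Finset.univ : Finset (Fin n)), fun x ↦ c k * f k x) U :=
      Finset.analyticOnNhd_sum _ fun k _ ↦ (analyticOnNhd_const.mul (hf k))
    have h2 : (∑ k ∈ (Finset.univ : Finset (Fin n)), fun x ↦ c k * f k x) =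
        fun x ↦ ∑ k, c k * f k x := by
      ext x; simp [Finset.sum_apply]
    rw [h2] at h1
    exact h1
  have hev : (fun x ↦ ∑ k, c k * f k x) =ᶠ[𝓝 z₀] 0 := by
    filter_upwards [hW.mem_nhds hz₀] with x hx
    simpa using hc x hx
  have key := han.eqOn_zero_of_preconnected_of_eventuallyEq_zero hU (hWU hz₀) hev
  intro x hx
  simpa using key hx

/-- **Injectivity travels (Card A, First lemma).** For a finite real-analytic family on a preconnected
domain `U`, "no nonzero combination vanishes on `V`" is the same statement for every nonempty open
`V ⊆ U` — so the coercivity COER₁ of the slaving map may be read on a near-horizon annulus or in the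
far field indifferently. [folklore] -/
theorem injective_family_iff_of_analytic {n : ℕ} {U V V' : Set E3} (f : Fin n → E3 → ℝ)
    (hU : IsPreconnected U) (hV : IsOpen V) (hVne : V.Nonempty) (hVU : V ⊆ U)
    (hV' : IsOpen V') (hV'ne : V'.Nonempty) (hV'U : V' ⊆ U) (hf : ∀ k, AnalyticOnNhd ℝ (f k) U) :
    (∀ c : Fin n → ℝ, (∀ x ∈ V, ∑ k, c k * f k x = 0) → c = 0) ↔
      (∀ c : Fin n → ℝ, (∀ x ∈ V', ∑ k, c k * f k x = 0) → c = 0) := by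
  constructor
  · intro h c hc
    exact h c fun x hx ↦ combination_eqOn_zero_of_analytic f hU hV' hV'ne hV'U hf c hc x (hVU hx)
  · intro h c hc
    exact h c fun x hx ↦ combination_eqOn_zero_of_analytic f hU hV hVne hVU hf c hc x (hV'U hx)

/-- **Finite-point coercivity (COER₁ shape).** If no nonzero combination of the family vanishes on
`U`, finitely many points of `U` already bound `‖c‖` from above by the pattern values (descending chain
of kernels + equivalence of norms on `Fin n → ℝ`). Statement only. [folklore] -/
theorem exists_finset_coercive {n : ℕ} {U : Set E3} (f : Fin n → E3 → ℝ)
    (hinj : ∀ c : Fin n → ℝ, (∀ x ∈ U, ∑ k, c k * f k x = 0) → c = 0) :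
    ∃ (s : Finset E3) (κ : ℝ), (↑s : Set E3) ⊆ U ∧ 0 < κ ∧
      ∀ c : Fin n → ℝ, κ * ‖c‖ ≤ ∑ x ∈ s, |∑ k, c k * f k x| := by
  sorry

/-! ## Card B: two monotonicities bound the re-basings of the increment oracle -/

/-- **(M1) slow ratios only shrink (Card B, First lemma).** A distance with one-sided Lipschitz rate
`σ` that is below the ray `θ·s` at time `a` stays below it for `σ ≤ θ`; so every threshold ray with
slope `> σ` is crossed at most once, and only downward: the `θs`-scale piece structure of a `σ`-slow
set only coarsens, with `≤ |S| - 1` merge events. [folklore] -/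
theorem slow_ratio_stays_below {d : ℝ → ℝ} {σ θ a : ℝ} (hσθ : σ ≤ θ)
    (hslow : ∀ s s', a ≤ s → s ≤ s' → d s' - d s ≤ σ * (s' - s)) (h0 : d a ≤ θ * a) :
    ∀ s, a ≤ s → d s ≤ θ * s := by
  intro s hs
  have h1 := hslow a s le_rfl hs
  have h2 : σ * (s - a) ≤ θ * (s - a) := mul_le_mul_of_nonneg_right hσθ (sub_nonneg.2 hs)
  nlinarith

/-- **(M2) a ballistic passage is ONE interval (Card B).** If the `n`-coordinate `φ` of an outsider
relative to a member is monotone on `[a,b]` (ballistic pair), the set of times at which `|φ| < ρ` is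
order-connected: every node of the (frozen) window hierarchy is opened and closed once per intruder.
[folklore] -/
theorem ballistic_passage_ordConnected {φ : ℝ → ℝ} {a b ρ : ℝ} (hmono : MonotoneOn φ (Icc a b)) :
    (Icc a b ∩ {s | |φ s| < ρ}).OrdConnected := by
  refine ⟨fun s₁ h₁ s₂ h₂ s hs ↦ ?_⟩
  have hsI : s ∈ Icc a b := ⟨h₁.1.1.trans hs.1, hs.2.trans h₂.1.2⟩
  refine ⟨hsI, ?_⟩
  have hlo : φ s₁ ≤ φ s := hmono h₁.1 hsI hs.1
  have hhi : φ s ≤ φ s₂ := hmono hsI h₂.1 hs.2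
  have a1 : -ρ < φ s₁ := (abs_lt.1 h₁.2).1
  have a2 : φ s₂ < ρ := (abs_lt.1 h₂.2).2
  show |φ s| < ρ
  exact abs_lt.2 ⟨by linarith, by linarith⟩

/-- The ballistic hypothesis of `stub_incrementOracle` (`W/2 ≤ ⟪ξ̇ⱼ − ξ̇ᵢ, n⟫` on `[t₁,t₂]`) makes the
`n`-coordinate monotone, so (M2) applies to it verbatim. [folklore] -/
theorem monotoneOn_of_deriv_lower_bound {φ : ℝ → ℝ} {a b W : ℝ} (hW : 0 ≤ W)
    (hφ : ∀ s ∈ Icc a b, HasDerivAt φ (deriv φ s) s) (hlb : ∀ s ∈ Icc a b, W / 2 ≤ deriv φ s) :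
    MonotoneOn φ (Icc a b) := by
  apply monotoneOn_of_deriv_nonneg (convex_Icc a b)
  · exact fun s hs ↦ (hφ s hs).continuousAt.continuousWithinAt
  · intro s hs
    exact (hφ s (interior_subset hs)).differentiableAt.differentiableWithinAt
  · intro s hs
    have := hlb s (interior_subset hs)
    linarith

end Summit.FinalStateConjecture.FinalStateConjecture.Cruxes.InertialRecession.SketchIdeator2R1
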